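import Mathlib
import Literature.NumberTheory.LFunctions.DeBruijnHDiv
import Literature.NumberTheory.LFunctions.DeBruijnNewmanProofs
import Summits.RiemannHypothesis.RiemannHypothesis.Theses.UniversalFactor
import Summits.RiemannHypothesis.RiemannHypothesis.Theorems.UniversalFactorLaplaceLoophole
import Summits.RiemannHypothesis.RiemannHypothesis.Theorems.UniversalFactorMixedFactorReduction

/-!
# Sketch — crux-ideate stmt-RiemannHypothesis-2575 (LaplaceLoophole), ideator 2, round 1

First lemmas of the idea card `random-clock-heat-deformation` as `Prop`s over existing
declarations (nothing is proved here; each `def` must elaborate).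

Notation. `F lam a := deBruijnHDiv (fun u ↦ exp(-(lam·u²)) · (1 + u²/a²))`, i.e. the transform of
the kernel `e^{lam u²} Φ(u) / (1 + u²/a²)`: the Laplace(a)-divided kernel moved UP the heat ray by `lam`.
`F 0 a` is the crux's `F_a` (kernel `Φ/(1+u²/a²)`), `F lam ∞` "=" `H_lam = deBruijnH lam`.
-/

noncomputable section

open MeasureTheory Set Filter
open Literature.NumberTheory.LFunctions

namespace Summit.RiemannHypothesis.RiemannHypothesis.Cruxes.LaplaceLoophole.RandomClock

/-- The two-parameter family: transform of `e^{lam u²} Φ(u)/(1+u²/a²)`. -/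
def F (lam a : ℝ) : ℂ → ℂ :=
  deBruijnHDiv (fun u : ℝ => Real.exp (-(lam * u ^ 2)) * (1 + u ^ 2 / a ^ 2))

/-- FIRST LEMMA 1 (subordination / random-clock identity): the Laplace(a) division is the
exponential(rate a²) average of the BACKWARD heat flow:
`F_{lam,a}(z) = a² ∫₀^∞ e^{-a² s} H_{lam - s}(z) ds`, from `1/(1+u²/a²) = a²∫₀^∞ e^{-a²s} e^{-s u²} ds`
and Fubini (absolutely convergent for every `z`). -/
def SubordinationIdentity : Prop :=
  ∀ (lam a : ℝ) (z : ℂ), 0 < a →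
    F lam a z = (a : ℂ) ^ 2 * ∫ s in Ioi (0 : ℝ), (Real.exp (-(a ^ 2 * s)) : ℂ) * deBruijnH (lam - s) z

/-- FIRST LEMMA 2 (heat monotonicity of the Laplace-divided kernel; de Bruijn Thm 13 with Δ = 0,
tree `DeBruijn1950.rootsInStrip_zero_gaussian`, applied to the admissible kernel
`e^{lam u²}Φ(u)/(1+u²/a²)` and the universal factor `e^{(lam'-lam)u²}`). -/
def HeatMonotone : Prop :=
  ∀ (a lam lam' : ℝ), 0 < a → lam ≤ lam' →
    HasOnlyRealZeros (F lam a) → HasOnlyRealZeros (F lam' a)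

/-- FIRST LEMMA 3 (Laguerre lift at every heat time: `(1 - D²/a²) F_{lam,a} = H_lam`, two
Hadamard-free Laguerre steps as in the tree's `UniversalFactor.laguerreLift`, which is `lam = 0`).
Consequence: `Λ_a ≥ Λ` for the de Bruijn–Newman constant `Λ_a` of the divided kernel. -/
def LaguerreLiftHeat : Prop :=
  ∀ (a lam : ℝ), 0 < a → HasOnlyRealZeros (F lam a) → HasOnlyRealZeros (deBruijnH lam)

/-- FIRST LEMMA 4 (Hurwitz closure down the heat ray at fixed `a`: `F lam a → F 0 a` locally
uniformly as `lam → 0⁺`, `F 0 a ≢ 0`; tree `rootsInStrip_of_tendstoLocallyUniformly`). -/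
def HurwitzDown : Prop :=
  ∀ a : ℝ, 0 < a → (∀ lam : ℝ, 0 < lam → HasOnlyRealZeros (F lam a)) → HasOnlyRealZeros (F 0 a)

/-- `F 0 a` is literally the crux's `F_a` (the kernel multiplier `exp(-(0·u²))·(1+u²/a²) = 1+u²/a²`). -/
theorem F_zero (a : ℝ) : F 0 a = deBruijnHDiv (fun u : ℝ => 1 + u ^ 2 / a ^ 2) := by
  simp [F]

/-- The RH-free conjunct isolated by the split: LP-ness along the heat ray is STABLE under the
Laplace(a) division for one fixed `a`, at every positive heat time (vacuous below `Λ`). -/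
def HeatRayLaplaceStability : Prop :=
  ∃ a : ℝ, 0 < a ∧ ∀ lam : ℝ, 0 < lam →
    HasOnlyRealZeros (deBruijnH lam) → HasOnlyRealZeros (F lam a)

/-- FIRST LEMMA 5 (the exact split of the crux): `LaplaceLoophole ↔ RH ∧ HeatRayLaplaceStability`.
(→): X → RH is the tree's `UniversalFactor.riemannHypothesis_of_laplaceLoophole`; X → B by
`HeatMonotone` from `lam = 0`. (←): RH → `H_lam ∈ LP` for all `lam ≥ 0` (`mono_deBruijnH_holds`,
`riemannHypothesis_iff_hasOnlyRealZeros_deBruijnH_zero`), then B and `HurwitzDown`. -/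
def Split : Prop :=
  Theses.UniversalFactor.LaplaceLoophole ↔ (RiemannHypothesis ∧ HeatRayLaplaceStability)

/-- Equivalent λ-axis form of the crux (HeatMonotone + HurwitzDown):
X ↔ some fixed Laplace division keeps `H_lam` Laguerre–Pólya at EVERY positive heat time. -/
def CruxOnTheHeatRay : Prop :=
  Theses.UniversalFactor.LaplaceLoophole ↔
    ∃ a : ℝ, 0 < a ∧ ∀ lam : ℝ, 0 < lam → HasOnlyRealZeros (F lam a)

/-- CONJECTURE P (the positive theorem of loophole shape; unconditional form at `lam ≥ 1/2`,
where `H_lam ∈ LP` is de Bruijn's theorem `hasOnlyRealZeros_deBruijnH_one_half_holds` + monotonicity):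
the Laplace loophole is OPEN at heat time `1/2` for all narrow enough kernels. -/
def LoopholeOpenAtHalf : Prop :=
  ∃ a₀ : ℝ, ∀ a : ℝ, a₀ ≤ a → HasOnlyRealZeros (F (1 / 2) a)

/-- CONJECTURE P, sInf-free general form: strictly above any real-rooted heat time the loophole
opens for large `a` (i.e. `Λ_a ↓ Λ` as `a → ∞`). Under RH this is `B` slice-wise with `a₀(lam) < ∞`;
the crux X is the boundedness of `a₀(lam)` as `lam ↓ 0`. -/
def LoopholeOpensAboveRealRootedTimes : Prop :=
  ∀ lam₀ lam : ℝ, lam₀ < lam → HasOnlyRealZeros (deBruijnH lam₀) →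
    ∃ a₀ : ℝ, ∀ a : ℝ, a₀ ≤ a → HasOnlyRealZeros (F lam a)

/-- WIDE KERNELS ALONG THE WHOLE HEAT RAY (Newman–Wu 'Case 3' from ζ): for `0 < a < π/8` with
`Φ(ia) ≠ 0` the divided kernel has EMPTY real-rooting set in `lam` (`Λ_a = +∞`): the residue tail
`a C e^{-λa²} e^{-a|x|}` beats the `e^{-πx/8 + O(log² x)}` bulk at every heat time. (`lam = 0` is the
tree's PROVED `WideKernelNoGo`.) -/
def WideKernelNoGoHeatRay : Prop :=
  ∀ (a lam : ℝ), 0 < a → a < Real.pi / 8 →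
    (∫ x in Ioi (0 : ℝ), deBruijnH 0 (x : ℂ) * (Real.cosh (a * x) : ℂ)) ≠ 0 →
      ¬ HasOnlyRealZeros (F lam a)


/-- CERTIFIED LOGIC OF THE SPLIT: `Split` follows from the two de Bruijn-1950-grade lemmas
`HeatMonotone` and `HurwitzDown` together with PROVED tree facts (X → RH, RH ↔ H_0 ∈ LP, de Bruijn
monotonicity along the heat ray). -/
theorem split_of (h1 : HeatMonotone) (h4 : HurwitzDown) : Split := by
  constructor
  · intro hX
    refine ⟨Theorems.UniversalFactor.riemannHypothesis_of_laplaceLoophole hX, ?_⟩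
    obtain ⟨a, ha, hF⟩ := hX
    refine ⟨a, ha, fun lam hlam _ => ?_⟩
    have h0 : HasOnlyRealZeros (F 0 a) := by rw [F_zero]; exact hF
    exact h1 a 0 lam ha hlam.le h0
  · rintro ⟨hRH, a, ha, hB⟩
    have hH0 : HasOnlyRealZeros (deBruijnH 0) :=
      riemannHypothesis_iff_hasOnlyRealZeros_deBruijnH_zero_holds.mp hRH
    have hall : ∀ lam : ℝ, 0 < lam → HasOnlyRealZeros (F lam a) := fun lam hlam =>
      hB lam hlam (mono_deBruijnH_holds hlam.le hH0)
    have h0 := h4 a ha hall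
    rw [F_zero] at h0
    exact ⟨a, ha, h0⟩

/-- And the λ-axis form follows the same way. -/
theorem cruxOnTheHeatRay_of (h1 : HeatMonotone) (h4 : HurwitzDown) : CruxOnTheHeatRay := by
  constructor
  · rintro ⟨a, ha, hF⟩
    have h0 : HasOnlyRealZeros (F 0 a) := by rw [F_zero]; exact hF
    exact ⟨a, ha, fun lam hlam => h1 a 0 lam ha hlam.le h0⟩
  · rintro ⟨a, ha, hall⟩
    have h0 := h4 a ha hall
    rw [F_zero] at h0
    exact ⟨a, ha, h0⟩

/-- The NON-POSITIVE-time half of `HeatMonotone` is already the tree's Gaussian step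
(`UniversalFactor.hasOnlyRealZeros_deBruijnHDiv_of_mul_exp`, multipliers `≥ 1`): for `lam ≤ lam' ≤ 0`
the multiplier `e^{-lam' u²}(1+u²/a²)` is `≥ 1` and `e^{-lam u²}(1+u²/a²) = (e^{-lam' u²}(1+u²/a²))·e^{(lam'-lam)u²}`.
The positive-time half needs the same three lemmas with domination by `deBruijnKernel lam'` instead of `m ≥ 1`. -/
theorem heatMonotone_nonpos (a lam lam' : ℝ) (h : lam ≤ lam') (h0 : lam' ≤ 0)
    (hF : HasOnlyRealZeros (F lam a)) : HasOnlyRealZeros (F lam' a) := by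
  have hmc : Continuous fun u : ℝ => Real.exp (-(lam' * u ^ 2)) * (1 + u ^ 2 / a ^ 2) := by fun_prop
  have hm1 : ∀ u : ℝ, 1 ≤ Real.exp (-(lam' * u ^ 2)) * (1 + u ^ 2 / a ^ 2) := fun u => by
    have h1 : 1 ≤ Real.exp (-(lam' * u ^ 2)) := Real.one_le_exp (by nlinarith [sq_nonneg u])
    have h2 : (1 : ℝ) ≤ 1 + u ^ 2 / a ^ 2 := by
      have : 0 ≤ u ^ 2 / a ^ 2 := by positivity
      linarith
    exact one_le_mul_of_one_le_of_one_le h1 h2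
  refine Theorems.UniversalFactor.hasOnlyRealZeros_deBruijnHDiv_of_mul_exp hmc hm1
    (t := lam' - lam) (by linarith) ?_
  have e : (fun u : ℝ => Real.exp (-(lam' * u ^ 2)) * (1 + u ^ 2 / a ^ 2) * Real.exp ((lam' - lam) * u ^ 2))
      = fun u : ℝ => Real.exp (-(lam * u ^ 2)) * (1 + u ^ 2 / a ^ 2) := by
    funext u
    rw [mul_right_comm, ← Real.exp_add]
    congr 2
    ring
  rw [e]
  exact hF

/-! ## PROOF of First Lemma 1 (the random-clock identity): Fubini on `(0,∞)²` with the product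
dominator `a²e^{-a²s} · deBruijnHBound lam |Im z| u`, inner integral by `integral_exp_mul_complex_Ioi`. -/

/-- The inner `s`-integral: `∫₀^∞ a² e^{-a²s} e^{(lam-s)u²} ds = a² e^{lam u²}/(a²+u²)`. -/
theorem integral_clock (lam a u : ℝ) (ha : 0 < a) :
    ∫ s in Ioi (0 : ℝ), ((a : ℂ) ^ 2 * (Real.exp (-(a ^ 2 * s)) : ℂ)) * (Real.exp ((lam - s) * u ^ 2) : ℂ)
      = (((a ^ 2 * Real.exp (lam * u ^ 2) / (a ^ 2 + u ^ 2) : ℝ)) : ℂ) := by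
  have hpos : (0 : ℝ) < a ^ 2 + u ^ 2 := by positivity
  have hre : (-(((a ^ 2 + u ^ 2 : ℝ)) : ℂ)).re < 0 := by
    simp only [Complex.neg_re, Complex.ofReal_re]; linarith
  -- rewrite the integrand as `C * cexp(-(a²+u²) s)`
  have hfun : (fun s : ℝ => ((a : ℂ) ^ 2 * (Real.exp (-(a ^ 2 * s)) : ℂ)) * (Real.exp ((lam - s) * u ^ 2) : ℂ))
      = fun s : ℝ => ((a : ℂ) ^ 2 * (Real.exp (lam * u ^ 2) : ℂ)) *
          Complex.exp (-(((a ^ 2 + u ^ 2 : ℝ)) : ℂ) * s) := by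
    funext s
    have : Real.exp (-(a ^ 2 * s)) * Real.exp ((lam - s) * u ^ 2)
        = Real.exp (lam * u ^ 2) * Real.exp (-(a ^ 2 + u ^ 2) * s) := by
      rw [← Real.exp_add, ← Real.exp_add]; congr 1; ring
    rw [mul_assoc, ← Complex.ofReal_mul, this, Complex.ofReal_mul, Complex.ofReal_exp (-(a ^ 2 + u ^ 2) * s)]
    push_cast
    ring
  rw [hfun, integral_const_mul, integral_exp_mul_complex_Ioi hre 0]
  simp only [Complex.ofReal_zero, mul_zero, Complex.exp_zero]
  have hne : ((a ^ 2 + u ^ 2 : ℝ) : ℂ) ≠ 0 := by exact_mod_cast hpos.ne'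
  push_cast
  field_simp

theorem subordination (lam a : ℝ) (z : ℂ) (ha : 0 < a) :
    deBruijnHDiv (fun u : ℝ => Real.exp (-(lam * u ^ 2)) * (1 + u ^ 2 / a ^ 2)) z =
      (a : ℂ) ^ 2 * ∫ s in Ioi (0 : ℝ), (Real.exp (-(a ^ 2 * s)) : ℂ) * deBruijnH (lam - s) z := by
  have ha2 : (0 : ℝ) < a ^ 2 := by positivity
  set μ : Measure ℝ := volume.restrict (Ioi (0 : ℝ)) with hμ
  -- joint integrand
  set G : ℝ → ℝ → ℂ := fun s u =>
    ((a : ℂ) ^ 2 * (Real.exp (-(a ^ 2 * s)) : ℂ)) * deBruijnHIntegrand (lam - s) z u with hG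
  -- (A) the right-hand side as an iterated integral of G
  have hR : (a : ℂ) ^ 2 * ∫ s in Ioi (0 : ℝ), (Real.exp (-(a ^ 2 * s)) : ℂ) * deBruijnH (lam - s) z
      = ∫ s in Ioi (0 : ℝ), ∫ u in Ioi (0 : ℝ), G s u := by
    rw [← integral_const_mul]
    refine setIntegral_congr_fun measurableSet_Ioi fun s _ => ?_
    rw [deBruijnH_eq_integral, ← mul_assoc, ← integral_const_mul]
  -- (B) measurability of `uncurry G` on the product of the restricted measures
  have hcontG : ContinuousOn (Function.uncurry G) (Ioi (0 : ℝ) ×ˢ Ioi (0 : ℝ)) := by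
    have hPhi : ContinuousOn (fun p : ℝ × ℝ => deBruijnPhi p.2) (Ioi (0 : ℝ) ×ˢ Ioi (0 : ℝ)) :=
      continuousOn_deBruijnPhi_Ici.comp continuous_snd.continuousOn
        (fun p hp => (Ioi_subset_Ici_self (mem_prod.1 hp).2))
    have h1 : ContinuousOn (fun p : ℝ × ℝ =>
        ((a : ℂ) ^ 2 * (Real.exp (-(a ^ 2 * p.1)) : ℂ)) *
          (((Real.exp ((lam - p.1) * p.2 ^ 2) : ℂ) * (deBruijnPhi p.2 : ℂ)) *
            Complex.cos (z * p.2))) (Ioi (0 : ℝ) ×ˢ Ioi (0 : ℝ)) := by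
      refine ContinuousOn.mul (Continuous.continuousOn (by fun_prop)) ?_
      refine ContinuousOn.mul (ContinuousOn.mul (Continuous.continuousOn (by fun_prop)) ?_)
        (Continuous.continuousOn (by fun_prop))
      exact Complex.continuous_ofReal.comp_continuousOn hPhi
    refine h1.congr fun p _ => ?_
    simp only [Function.uncurry, hG, deBruijnHIntegrand]
  have hmeasG : AEStronglyMeasurable (Function.uncurry G) (μ.prod μ) := by
    rw [hμ, Measure.prod_restrict]
    exact hcontG.aestronglyMeasurable (measurableSet_Ioi.prod measurableSet_Ioi)
  -- (C) domination by a product of integrable functions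
  set g : ℝ × ℝ → ℝ := fun p =>
    (a ^ 2 * Real.exp (-(a ^ 2 * p.1))) * deBruijnHBound lam |z.im| p.2 with hg
  have hgi : Integrable g (μ.prod μ) := by
    have h1 : Integrable (fun s : ℝ => a ^ 2 * Real.exp (-(a ^ 2 * s))) μ := by
      have h0 : IntegrableOn (fun s : ℝ => Real.exp (-(a ^ 2) * s)) (Ioi 0) :=
        integrableOn_exp_mul_Ioi (by linarith) 0
      have h0' : IntegrableOn (fun s : ℝ => Real.exp (-(a ^ 2 * s))) (Ioi 0) := by
        refine h0.congr_fun (fun s _ => ?_) measurableSet_Ioi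
        simp [neg_mul]
      exact h0'.const_mul (a ^ 2)
    have h2 : Integrable (fun u : ℝ => deBruijnHBound lam |z.im| u) μ :=
      integrableOn_deBruijnHBound lam |z.im|
    exact h1.mul_prod h2
  have hbound : ∀ᵐ p ∂(μ.prod μ), ‖Function.uncurry G p‖ ≤ g p := by
    rw [hμ, Measure.prod_restrict]
    refine ae_restrict_of_forall_mem (measurableSet_Ioi.prod measurableSet_Ioi) fun p hp => ?_
    obtain ⟨hs, hu⟩ := mem_prod.1 hp
    have hs' : (0 : ℝ) < p.1 := hs
    have hu' : (0 : ℝ) < p.2 := hu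
    simp only [Function.uncurry, hG, hg]
    rw [norm_mul, norm_mul, Complex.norm_real, Real.norm_eq_abs, abs_of_pos (Real.exp_pos _),
      norm_pow, Complex.norm_real, Real.norm_eq_abs, abs_of_pos ha]
    refine mul_le_mul_of_nonneg_left ?_ (by positivity)
    exact norm_deBruijnHIntegrand_le (by linarith) le_rfl hu'.le
  have hint : Integrable (Function.uncurry G) (μ.prod μ) :=
    hgi.mono' hmeasG hbound
  -- (D) swap the integrals
  have hswap : ∫ s in Ioi (0 : ℝ), ∫ u in Ioi (0 : ℝ), G s u = ∫ u in Ioi (0 : ℝ), ∫ s in Ioi (0 : ℝ), G s u :=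
    integral_integral_swap hint
  -- (E) the inner `s`-integral for fixed `u > 0`
  have hinner : ∀ u : ℝ, 0 < u → ∫ s in Ioi (0 : ℝ), G s u =
      ((deBruijnPhi u / (Real.exp (-(lam * u ^ 2)) * (1 + u ^ 2 / a ^ 2)) : ℝ) : ℂ) *
        Complex.cos (z * u) := by
    intro u hu
    have e1 : (fun s : ℝ => G s u) = fun s : ℝ =>
        (((a : ℂ) ^ 2 * (Real.exp (-(a ^ 2 * s)) : ℂ)) * (Real.exp ((lam - s) * u ^ 2) : ℂ)) *
          ((deBruijnPhi u : ℂ) * Complex.cos (z * u)) := by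
      funext s
      simp only [hG, deBruijnHIntegrand]
      push_cast
      ring
    rw [e1, integral_mul_const, integral_clock lam a u ha]
    have hane : a ≠ 0 := ha.ne'
    have hd : Real.exp (-(lam * u ^ 2)) * (1 + u ^ 2 / a ^ 2) ≠ 0 := by positivity
    have key : deBruijnPhi u / (Real.exp (-(lam * u ^ 2)) * (1 + u ^ 2 / a ^ 2))
        = a ^ 2 * Real.exp (lam * u ^ 2) / (a ^ 2 + u ^ 2) * deBruijnPhi u := by
      rw [Real.exp_neg]
      field_simp
    rw [key]
    push_cast
    ring
  -- conclude
  rw [deBruijnHDiv, hR, hswap]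
  refine (setIntegral_congr_fun measurableSet_Ioi fun u hu => ?_)
  exact (hinner u hu).symm


/-- FIRST LEMMA 1 HOLDS. -/
theorem subordinationIdentity_holds : SubordinationIdentity :=
  fun lam a z ha => subordination lam a z ha

-- sanity: the crux decl is in scope and the split conjuncts typecheck against it
example (h : Split) (hX : Theses.UniversalFactor.LaplaceLoophole) : RiemannHypothesis := (h.mp hX).1

end Summit.RiemannHypothesis.RiemannHypothesis.Cruxes.LaplaceLoophole.RandomClock

end
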